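import Summits.QuantumFields.BalabanUV.T4Continuum.Spine.NE1p.DressedTowerWitness
import Summits.QuantumFields.BalabanUV.T4Continuum.Spine.NE1p.DressedWindowScheduleModWin

/-!
# T⁴ programme, spine estimate NE1′ (node O3b/H2) — FUNCTION-LEVEL NON-VACUITY OF THE ASSEMBLED SLICE-WINDOW FACE AT EVERY
# CUTOFF, part 1: the datum with a LIVE GENERATION in the observable exponent, ONE cutoff-free `WindowScheduleModWin`, the SAME
# K-free `U` as row W5 (formalisation crew `b2b-balaban-t4-ne1p-formalise-*`, leaf seat 03, generation 2, row W7; own-initiative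
# consistency item, NOT a crew estimate row)

Cell `pub-balaban`, sub-cell `t4`, BINDER-OWNERS row NE1′ (owner lineage t4-ne1p-p1).  ADDITIVE — imports this seat's row W5
part 1 `Spine/NE1p/DressedTowerWitness` (p213903: `LW`, `ψ = LW⁻²`, `flAt`, `atomW`, `defW`, `dirW`, `zeroExp`, the two-atom
calculus) and leaf-04's
`Spine/NE1p/DressedWindowScheduleModWin` (row S1e part 2: the assembled leaf's schedule with the FULL GAP and its cutoff-free
`geometric`, p213785) ONLY; modifies nothing.  Part 2 (`DressedTowerWitnessSliceEnd`) discharges the binders of the assembled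
slice-window END of row S1e and reaches END-B ∕ the ROOT by name.

WHY.  Row W5 certifies the WINDOW face (F-4 `hP` DISPLAYED and inhabited by a constant) at every cutoff with ONE `U` and ONE
schedule; row W2 certifies an ASSEMBLED face (the H2 dictionary `hQ` with a LIVE generation, fresh pairs, margins) at `K = 2` only and
on the floor face of LF-1.  The crew's terminal object is the ASSEMBLED SLICE-WINDOW face (row S1e: `hP` PRODUCED from `hQ`∕`hSg`∕
(I4′) links with per-step cross-family margins — LF-2 retired).  This part builds its datum, uniformly in the cutoff:
* §1 ONE cutoff-free schedule `Wm := WindowScheduleModWin.geometric 1 1 ψ (ψ∕4) 1 0` (leaf-04): `σ k = ψ^{k+1}∕4`, `wc k = ψ^{k+1}∕2`,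
  `ϱc k = ψ^{k+1}`, `ϱ₁ k = ψ^k`, windows `bondBall (c_M ψ^k)`; its (w4) ratio is the CONSTANT `2σ k = ½·ϱc k` (`hratioM`), so row
  W5's `UW` (κ = ½, `L := 2·alphaCell ½`, `C = 2`, `m = ¼`) serves THIS face too — one `U` for both faces and every cutoff.
* §2 the datum at cutoff `K`: booking `BM K` (one family born at scale `0`, POSITIVE size `a_K·ψ^{k+1}∕2`), trajectory `TM K`, tower
  `towerM`; the family's OWN generation `0` is LIVE in its met component's exponent at every step (`Sg k b = {(b,0)}`): the
  observable-attached exponent BY THE ASSEMBLY'S DICTIONARY `𝒬M K k U z := c₀·(FnM K 0 k (U+z) − FnM K 0 k (U+0))`, `c₀ = ¼`, which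
  for the affine toy functional is `¼·a_K·z₀₀` — background-FREE but fluctuation-DEPENDENT, so the weights `e^{−𝒬}` at the two
  atoms `0`, `z_k ≡ ψ^{k+1}∕4` are `1` and `e^{−x_k}` (`x_k = ¼·a_K·ψ^{k+1}∕4`) and the dressed operation is a genuine WEIGHTED
  two-point average (`wOp_weighted`); the carried functional `FnM K 0 k U = a_K·(U₀₀ + shift k)` with
  `shift (k+1) = shift k + (ψ^{k+1}∕4)·e^{−x_k}∕(1 + e^{−x_k})` satisfies `hFn` AS AN EQUATION (`FnM_succ`) and the dictionary `hQ`
  AS AN EQUATION (`hQM`); ACTION exponent `𝒜 ≡ 0` (declared: `hB`∕`hE` by W5's constant lemmas; rows W1∕W2 carry non-trivial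
  action weights at `K = 2`).
* §3 the FRESH PAIRS `hpairx` by explicit directions: at the reference atom the zero field with declared bound `δf_k = ψ^{k+1}∕4`, at
  the second atom the field `z_k` itself (`relGauge_pairs`); `rel := Eq`.

WHAT IT IS NOT.  Not an estimate; nothing of Bałaban's densities or of [Balaban1989LargeFieldII] (1.71)–(1.75) pp. 379–380 is
encoded (CONTEXT only); no `def … : Prop`; [folklore] toy kernel mathematics, 0 sorry, 0 citations.  VALUE (with part 2) = a
joint-satisfiability certificate, uniform in the cutoff, for the assembled slice-window binder family with a live generation.

HONEST FRAMING.  Rung (B)+1 bookkeeping on ONE finite four-torus of fixed physical size — NOT infinite volume, NOT a mass gap, NOT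
OS on ℝ⁴, NOT the Clay problem, NOT summit progress.  NE1′ is NOT PRINTED and NOT PROVED; every headline reads «NE1′ ⇐ the named
binders»; spine PROVED 0∕9 unchanged.  HONEST DEPENDENCY: continuum YM on T⁴ ⇐ BetaPertH ∧ nine spine estimates (0/9 proved);
BetaPertH ⇐ (D1) ∧ (D4) ∧ CAP+tail; G-an2-4 gates asym, D1 and NE2/3/4.
-/

noncomputable section

namespace Summit.QuantumFields.BalabanUV.T4Continuum.NE1p.DressedTowerWitnessSlice

open MeasureTheory Set Metric Filter Finset
open scoped BigOperators
open Literature.MathematicalPhysics.QuantumFieldTheory.Balaban1983to89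
open Literature.MathematicalPhysics.QuantumFieldTheory.Balaban1983to89.T4TermFormat
open Literature.MathematicalPhysics.QuantumFieldTheory.Balaban1983to89.T4TermFormat.Booking
open Literature.MathematicalPhysics.QuantumFieldTheory.Balaban1983to89.T4GatedBooking
open Literature.MathematicalPhysics.QuantumFieldTheory.Balaban1983to89.T4TrajectoryComparison
open T4TrajectoryModulus (bondBall bondBall_add_mem bondBall_latMove_add_mem bondBall_diam)
open T4BlockTransport (Fld NDir latMove latN Site norm_dir_le)
open T4BirthChartTransport (GaugeInvariant BirthSlice RelGauge)
open T4TrajectoryDensity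
open Summit.QuantumFields.BalabanUV.T4Continuum.T4TrajectoryDensityDressed
open Summit.QuantumFields.BalabanUV.T4Continuum.T4TrajectoryDensityWitness
open Summit.QuantumFields.BalabanUV.T4Continuum.NE1p.DressedRoot
open Summit.QuantumFields.BalabanUV.T4Continuum.NE1p.DressedUniformConstants
open Summit.QuantumFields.BalabanUV.T4Continuum.NE1p.DressedWindowScheduleWin
open Summit.QuantumFields.BalabanUV.T4Continuum.NE1p.DressedWindowScheduleModWin
open Summit.QuantumFields.BalabanUV.T4Continuum.NE1p.DressedTowerWitness

/-! ## §1 ONE cutoff-free schedule for the assembled leaf, with W5's ratio `κ = ½` [decided toy] -/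

/-- [arith] [folklore] `0 < ψ∕4`. -/
theorem psi4_pos : 0 < (LW ^ 2)⁻¹ / 4 := by have := psi_pos; positivity

/-- [arith] [folklore] `2·(ψ∕4) ≤ 1` (the slice window `w = 1` dominates the fluctuation diameters). -/
theorem two_psi4_le_one : 2 * ((LW ^ 2)⁻¹ / 4) ≤ 1 := by have := psi_le_one; linarith

/-- **THE ONE CUTOFF-FREE SCHEDULE OF THE ASSEMBLED LEAF** [decided toy]: leaf-04's `WindowScheduleModWin.geometric` with ratio
`ψ`, fluctuation scale `σ₀ = ψ∕4`, radius scale `ϱ₀ = 1 = r`, final window `0`, slice window `w = 1`. [folklore] -/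
def Wm : WindowScheduleModWin 1 1 :=
  WindowScheduleModWin.geometric 1 1 ((LW ^ 2)⁻¹) ((LW ^ 2)⁻¹ / 4) 1 0 psi_pos psi_lt_one psi4_pos two_psi4_le_one one_pos
    le_rfl

/-- The birth-window radius `c_M = ((1 + 2ψ)·ψ∕4 + 1)∕(1 − ψ)` (cutoff-free). [folklore] -/
def cM : ℝ := ((1 + 2 * (LW ^ 2)⁻¹) * ((LW ^ 2)⁻¹ / 4) + 1) / (1 - (LW ^ 2)⁻¹)

/-- [arith] [folklore] `0 < c_M`. -/
theorem cM_pos : 0 < cM := by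
  have h1 := psi_pos; have h2 := psi_lt_one
  unfold cM
  exact div_pos (by positivity) (by linarith)

/-- [arith] [folklore] The schedule's fields, unfolded. -/
theorem Wm_ρw (k : ℕ) : Wm.ρw k = cM * ((LW ^ 2)⁻¹) ^ k := by
  show 0 + ((1 + 2 * (LW ^ 2)⁻¹) * ((LW ^ 2)⁻¹ / 4) + 1) / (1 - (LW ^ 2)⁻¹) * ((LW ^ 2)⁻¹) ^ k = _
  rw [zero_add]; rfl

/-- [arith] [folklore] -/ theorem Wm_σ (k : ℕ) : Wm.σ k = (LW ^ 2)⁻¹ / 4 * ((LW ^ 2)⁻¹) ^ k := rfl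
/-- [arith] [folklore] -/ theorem Wm_ϱc (k : ℕ) : Wm.ϱc k = 1 * ((LW ^ 2)⁻¹) ^ (k + 1) := rfl
/-- [arith] [folklore] -/ theorem Wm_wc (k : ℕ) : Wm.wc k = 2 * ((LW ^ 2)⁻¹ / 4) * ((LW ^ 2)⁻¹) ^ k := rfl
/-- [arith] [folklore] -/ theorem Wm_ϱ₁ (k : ℕ) : Wm.ϱ₁ k = 1 * ((LW ^ 2)⁻¹) ^ k := rfl

/-- [arith] [folklore] The birth window is `bondBall c_M`. -/
theorem Wm_ρw_zero : Wm.ρw 0 = cM := by rw [Wm_ρw, pow_zero, mul_one]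

/-- [folklore] The zero background lies in every window, at every step of every cutoff. -/
theorem zero_mem_windowM (k : ℕ) : (0 : Fld 4 ℂ) ∈ (bondBall 4 (Wm.ρw k) : Set (Fld 4 ℂ)) :=
  WindowScheduleModWin.geometric_zero_mem_window (r := 1) psi_pos psi_lt_one psi4_pos two_psi4_le_one one_pos le_rfl le_rfl k

/-- **THE SCHEDULE's K-FREE RATIO** `2σ k = ψ^{k+1}∕2 = ½·ϱc k` — row W5's `κ = ½`, so the SAME `UW` serves this face. [folklore] -/
theorem hratioM : ∀ k, 2 * Wm.σ k ≤ 1 / 2 * Wm.ϱc k := fun k => by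
  rw [Wm_σ, Wm_ϱc, pow_succ]; exact le_of_eq (by ring)

/-! ## §2 The datum at cutoff `K` with a LIVE generation in the exponent [decided toy] -/

/-- The fresh transverse defect ∕ size of the second atom at step `k`: `δf_k = ψ^{k+1}∕4` (`= (atomW (k+1))₀₀`). [folklore] -/
def dfW (k : ℕ) : ℝ := ((LW ^ 2)⁻¹) ^ (k + 1) / 4

/-- [arith] [folklore] -/ theorem dfW_pos (k : ℕ) : 0 < dfW k := by unfold dfW; have := psi_pos; positivity

/-- The birth amplitude at cutoff `K`: `a_K = τ^K ∕ (C·(c_M + 3))`, `τ = L⁻³`, `C = 2` — the source decay, i.e. the class. [folklore] -/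
def aM (K : ℕ) : ℝ := (LW⁻¹ ^ 3) ^ K / (2 * (cM + 3))

/-- [arith] [folklore] -/
theorem aM_pos (K : ℕ) : 0 < aM K := by unfold aM; have := LW_pos; have := cM_pos; positivity

/-- TOY BOOKING at cutoff `K` [decided toy]: one observable-attached family, born at scale `0`, POSITIVE size `a_K·ψ^{k+1}∕2` at
scale `k` (the defect of step `k`, inside the chart window `wc k = ψ^{k+1}∕2`).  Nothing of Bałaban's is modelled. [folklore] -/
def BM (K : ℕ) : T4TermFormat.Booking where
  K := K
  Dom := Unit
  domScale := fun _ => 0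
  treeLen := fun _ => 0
  treeLen_nonneg := fun _ => le_rfl
  balSize := fun _ => 0
  Birth := Unit
  births := {()}
  mem_births := fun b => by simp
  birthScale := fun _ => 0
  birth_le := fun _ => Nat.zero_le K
  loc := fun _ => ()
  loc_scale := fun _ => rfl
  Cube := Fin (K + 1)
  cubes := Finset.univ
  mem_cubes := fun q => Finset.mem_univ q
  cubeScale := fun q => q.val
  cube_le := fun q => Nat.lt_succ_iff.mp q.isLt
  feltAt := fun _ => {()}
  felt_birth_le := fun _ _ _ => Nat.zero_le _
  size := fun _ k => aM K * defW (k + 1)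
  size_nonneg := fun _ k => (mul_pos (aM_pos K) (defW_pos (k + 1))).le
  pair := fun _ _ _ => 0

/-- TOY TRAJECTORY at cutoff `K` [decided toy]: one generation (the birth, size `a_K·(c_M + 3)`), `lin b 0 k = a_K·ψ^{k+1}∕2`. [folklore] -/
def TM (K : ℕ) : Trajectory (BM K) where
  lin := fun _ k' k => if k' = 0 then aM K * defW (k + 1) else 0
  lin_nonneg := fun _ k' k => by
    split_ifs
    · exact (mul_pos (aM_pos K) (defW_pos (k + 1))).le
    · exact le_rfl
  gen := fun _ k' => if k' = 0 then aM K * (cM + 3) else 0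
  gen_nonneg := fun _ k' => by
    split_ifs
    · exact (mul_pos (aM_pos K) (by linarith [cM_pos])).le
    · exact le_rfl
  size_le := fun b k _ _ => by
    show aM K * defW (k + 1) ≤ ∑ k' ∈ Icc 0 k, (if k' = 0 then aM K * defW (k + 1) else 0)
    rw [Finset.sum_ite_eq' (Icc 0 k) 0 (fun _ => aM K * defW (k + 1))]
    simp

/-- TOY TOWER [decided toy]: the datum at every cutoff (one run parameter). [folklore] -/
def towerM : DressedTower Unit where
  B := fun _ K => BM K
  K_eq := fun _ _ => rfl
  T := fun _ K => TM K

/-- The exponent coupling of the second atom at step `k`: `x_k = ¼·a_K·δf_k`. [folklore] -/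
def xM (K k : ℕ) : ℝ := 1 / 4 * aM K * dfW k

/-- The weight of the second atom: `e^{−x_k} ∈ (0, 1)`. [folklore] -/
def wtM (K k : ℕ) : ℝ := Real.exp (-xM K k)

/-- [arith] [folklore] -/ theorem wtM_pos (K k : ℕ) : 0 < wtM K k := Real.exp_pos _

/-- The accumulated dressing: `shift 0 = 0`, `shift (k+1) = shift k + δf_k·e^{−x_k}∕(1 + e^{−x_k})`. [folklore] -/
def shiftM (K : ℕ) : ℕ → ℝ
  | 0 => 0
  | k + 1 => shiftM K k + dfW k * (wtM K k / (1 + wtM K k))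

/-- THE CARRIED FUNCTIONALS at cutoff `K` [decided toy]: generation `0` at scale `k` is `a_K·(U₀₀ + shift k)`; later generations `0`. [folklore] -/
def FnM (K : ℕ) (k' k : ℕ) (U : Fld 4 ℂ) : ℂ := if k' = 0 then (aM K : ℂ) * (ev₀₀ U + (shiftM K k : ℂ)) else 0

/-- THE OBSERVABLE-ATTACHED EXPONENT BY THE ASSEMBLY'S DICTIONARY [decided toy]: `c₀·(FnM K 0 k (U+z) − FnM K 0 k (U+0))` with
`c₀ = ¼` IS `¼·a_K·z₀₀` for the affine functional — background-free, fluctuation-dependent (`hQM`). [folklore] -/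
def 𝒬M (K : ℕ) (_k : ℕ) (_U z : Fld 4 ℂ) : ℂ := ((1 / 4 : ℝ) : ℂ) * (aM K : ℂ) * ev₀₀ z

/-- The weight at the reference atom `0` is `1`. [folklore] -/
theorem expWeight_M_zero (K k : ℕ) (U : Fld 4 ℂ) : expWeight base₁ (zeroExp + 𝒬M K k) U 0 = 1 := by
  simp [expWeight_apply, base₁, zeroExp, 𝒬M]

/-- The weight at the second atom is `e^{−x_k}`. [folklore] -/
theorem expWeight_M_atom (K k : ℕ) (U : Fld 4 ℂ) :
    expWeight base₁ (zeroExp + 𝒬M K k) U (atomW (k + 1)) = (wtM K k : ℂ) := by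
  simp only [expWeight_apply, base₁, zeroExp, 𝒬M, Pi.add_apply, ev₀₀_atomW, zero_add, Complex.ofReal_one, one_mul, wtM, xM,
    dfW, Complex.ofReal_exp]
  congr 1
  push_cast
  ring

/-- **THE DRESSED OPERATION IN CLOSED FORM — A WEIGHTED TWO-POINT AVERAGE** [folklore]: with the live generation in the exponent,
`wOp … U h = (h 0 + e^{−x_k}·h z_k)∕(1 + e^{−x_k})`. -/
theorem wOp_weighted (K k : ℕ) (U : Fld 4 ℂ) (h : Fld 4 ℂ → ℂ) :
    wOp (expWeight base₁ (zeroExp + 𝒬M K k)) (flAt (atomW (k + 1))) 0 U h =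
      ((1 + wtM K k : ℝ) : ℂ)⁻¹ * (h 0 + (wtM K k : ℂ) * h (atomW (k + 1))) := by
  have hpos : (0 : ℝ) < 1 + wtM K k := by have := wtM_pos K k; linarith
  have hne : ((1 + wtM K k : ℝ) : ℂ) ≠ 0 := by exact_mod_cast hpos.ne'
  have hint : ∫ z, expWeight base₁ (zeroExp + 𝒬M K k) U z ∂flAt (atomW (k + 1)) = ((1 + wtM K k : ℝ) : ℂ) := by
    rw [integral_flAt, expWeight_M_zero, expWeight_M_atom]; push_cast; ring
  rw [wOp_of_pos (integrable_flAt _ _) (by rw [hint]; exact hne), hint, integral_flAt, expWeight_M_zero, expWeight_M_atom]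
  simp only [smul_eq_mul, one_mul]

/-- `hFn` AS AN EQUATION: the step `k → k+1` is the dressed operation (live exponent, two-atom measure) on the translates. [folklore] -/
theorem FnM_succ (K k' k : ℕ) (U : Fld 4 ℂ) :
    FnM K k' (k + 1) U =
      wOp (expWeight base₁ (zeroExp + 𝒬M K k)) (flAt (atomW (k + 1))) 0 U (fun z => FnM K k' k (U + z)) := by
  have hpos : (0 : ℝ) < 1 + wtM K k := by have := wtM_pos K k; linarith
  have hne : (1 : ℂ) + (wtM K k : ℂ) ≠ 0 := by exact_mod_cast hpos.ne'
  rw [wOp_weighted]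
  by_cases h : k' = 0
  · subst h
    simp only [FnM, ↓reduceIte, shiftM, ev₀₀_add, ev₀₀_atomW, add_zero, dfW]
    push_cast
    field_simp
    ring
  · simp [FnM, h]

/-- THE DICTIONARY `hQ` AS AN EQUATION [folklore]: the centred observable-attached exponent IS `c₀` times the fresh difference of
the live generation `(b, 0)` at the pair `(U+z, U+0)`. -/
theorem hQM (K : ℕ) (b : (BM K).Birth) (k : ℕ) :
    (fun U z => 𝒬M K k U z - (fun (_ : Fld 4 ℂ) => (0 : ℂ)) U) =
      fun U z => ((1 / 4 : ℝ) : ℂ) * ∑ p ∈ ({(b, 0)} : Finset ((BM K).Birth × ℕ)),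
        (FnM K p.2 k (U + z) - FnM K p.2 k (U + (fun (_ : (BM K).Birth) (_ : ℕ) => (0 : Fld 4 ℂ)) b k)) := by
  funext U z
  simp only [Finset.sum_singleton, FnM, ↓reduceIte, ev₀₀_add, add_zero, 𝒬M, sub_zero]
  ring

/-! ## §3 The fresh pairs: explicit gauge directions at both atoms [folklore] -/

/-- The direction realising the fresh pair at the second atom: the field `z_k` itself with declared bound `δf_k`. [folklore] -/
def dirAtom (k : ℕ) : NDir 4 ℂ := fldDir (atomW (k + 1)) (dfW k) fun x ν => by
  simp only [atomW, Complex.norm_real, Real.norm_eq_abs, dfW]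
  rw [abs_of_nonneg (by have := psi_pos; positivity)]

/-- The direction realising the trivial pair at the reference atom: the zero field with declared bound `δf_k > 0`. [folklore] -/
def dirNull (k : ℕ) : NDir 4 ℂ := fldDir 0 (dfW k) fun x ν => by simpa using (dfW_pos k).le

/-- **`hpairx` AT BOTH ATOMS** [folklore]: for μ-a.e. fluctuation `z` (i.e. `z = 0` or `z = z_k`) and EVERY base `Y`, the pair
`(Y + 0, Y + z)` is in relative `Eq`-gauge with defect `δf_k` — along `dirNull k` resp. `dirAtom k`. -/
theorem relGauge_pairs (k : ℕ) :
    ∀ᵐ z ∂flAt (atomW (k + 1)), ∀ Y : Fld 4 ℂ,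
      RelGauge (fun U U' : Fld 4 ℂ => U = U') latMove latN (Y + 0) (Y + z) (dfW k) := by
  refine ae_flAt.mpr ⟨fun Y => ⟨dirNull k, dfW_pos k, le_rfl, ?_⟩, fun Y => ⟨dirAtom k, dfW_pos k, le_rfl, ?_⟩⟩
  · show Y + 0 = latMove (Y + 0) (dirNull k) 1
    rw [dirNull, latMove_fldDir_one, add_zero, add_zero]
  · show Y + atomW (k + 1) = latMove (Y + 0) (dirAtom k) 1
    rw [dirAtom, latMove_fldDir_one, add_zero]

/-! ## §4 The schedule-independent END binders on the datum [folklore] -/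

/-- `hsl` (w1): birth slices on the birth window `bondBall c_M`, bound `a_K·(c_M + 3)`; later generations `0`. [folklore] -/
theorem hslM (K : ℕ) (b : (BM K).Birth) (k' : ℕ) :
    BirthSlice (FnM K k' k') latMove latN (bondBall 4 (Wm.ρw k') : Set (Fld 4 ℂ)) 1 1 ((TM K).gen b k') := by
  intro U hU p hp hp1
  by_cases hk : k' = 0
  · subst hk
    have hUc : ‖ev₀₀ U‖ ≤ cM := by rw [← Wm_ρw_zero]; exact hU 0 0
    refine ⟨ball 0 (3 / latN p), ?_, fun t ht => ?_, discs_subset_ball hp hp1 (by norm_num)⟩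
    · simp only [FnM, ↓reduceIte, ev₀₀_latMove]; fun_prop
    · show ‖FnM K 0 0 (latMove U p t)‖ ≤ (if (0 : ℕ) = 0 then aM K * (cM + 3) else 0)
      simp only [FnM, ↓reduceIte, ev₀₀_latMove, shiftM, Complex.ofReal_zero, add_zero]
      have h3 := norm_t_mul_le p hp ht
      rw [norm_mul, Complex.norm_real, Real.norm_eq_abs, abs_of_pos (aM_pos K)]
      calc aM K * ‖ev₀₀ U + t * ev₀₀ p.1.1‖ ≤ aM K * (‖ev₀₀ U‖ + ‖t * ev₀₀ p.1.1‖) :=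
            mul_le_mul_of_nonneg_left (norm_add_le _ _) (aM_pos K).le
        _ ≤ aM K * (cM + 3) := mul_le_mul_of_nonneg_left (by linarith) (aM_pos K).le
  · refine ⟨univ, ?_, fun t _ => ?_, fun _ _ => subset_univ _⟩
    · simp only [FnM, if_neg hk]; fun_prop
    · show ‖FnM K k' k' (latMove U p t)‖ ≤ (if k' = 0 then aM K * (cM + 3) else 0)
      simp [FnM, hk]

/-- `hDμ`: both atoms of the step-`k` measure lie in `bondBall (σ k) = bondBall (ψ^{k+1}∕4)`. [folklore] -/
theorem hDμM (k : ℕ) : ∀ᵐ z ∂flAt (atomW (k + 1)), z ∈ (bondBall 4 (Wm.σ k) : Set (Fld 4 ℂ)) := by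
  refine ae_flAt.mpr ⟨fun x ν => ?_, fun x ν => ?_⟩
  · rw [Wm_σ, Pi.zero_apply, Pi.zero_apply, norm_zero]; have := psi_pos; positivity
  · rw [Wm_σ, pow_succ]
    simp only [atomW, Complex.norm_real, Real.norm_eq_abs]
    rw [abs_of_nonneg (by have := psi_pos; positivity), pow_succ]
    exact le_of_eq (by ring)

/-- `hz₁`: the reference fluctuation `0` lies in every fluctuation domain. [folklore] -/
theorem hz₁M (k : ℕ) : (0 : Fld 4 ℂ) ∈ (bondBall 4 (Wm.σ k) : Set (Fld 4 ℂ)) := fun x ν => by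
  rw [Wm_σ, Pi.zero_apply, Pi.zero_apply, norm_zero]; have := psi_pos; positivity

/-- `hlin` — THE TRAJECTORY CURRENCY FROM THE CARRIED FUNCTIONALS: base `0`, gauge image `δ_{k+1}·e₀₀` along `dirW (k+1)` (defect
`ψ^{k+1}∕2`), `lin b 0 k = a_K·ψ^{k+1}∕2` EXACTLY the oscillation (the dressing cancels); later generations `lin = 0`. [folklore] -/
theorem hlinM (K : ℕ) (b : (BM K).Birth) (k' k : ℕ) (ε : ℝ) (hε : 0 < ε) :
    ∃ U₀ ∈ (bondBall 4 (Wm.ρw k) : Set (Fld 4 ℂ)), ∃ U₁ : Fld 4 ℂ,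
      RelGauge (fun U U' : Fld 4 ℂ => U = U') latMove latN U₀ U₁ (defW (k + 1)) ∧
        (TM K).lin b k' k ≤ ‖FnM K k' k U₁ - FnM K k' k U₀‖ + ε := by
  refine ⟨0, zero_mem_windowM k, latMove 0 (dirW (k + 1)) 1, ⟨dirW (k + 1), defW_pos (k + 1), le_rfl, rfl⟩, ?_⟩
  show (if k' = 0 then aM K * defW (k + 1) else 0) ≤ _
  by_cases hk : k' = 0
  · subst hk
    simp only [↓reduceIte, FnM, ev₀₀_move_dirW, ev₀₀_zero, zero_add]
    rw [show (aM K : ℂ) * (((defW (k + 1) : ℝ) : ℂ) + (shiftM K k : ℂ)) - (aM K : ℂ) * (shiftM K k : ℂ) =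
        ((aM K * defW (k + 1) : ℝ) : ℂ) by push_cast; ring,
      Complex.norm_real, Real.norm_eq_abs, abs_of_pos (mul_pos (aM_pos K) (defW_pos (k + 1)))]
    linarith
  · simp only [if_neg hk]; positivity

/-- (w3-book) `hcount`: one live family, `N₀ = 1`, `Λ = L⁴ ≥ 1`. [folklore] -/
theorem hcountM (K : ℕ) : ∀ (k : ℕ) (b : (BM K).Birth), ∀ j ≤ k,
    (((({b} : Finset (BM K).Birth)).filter fun f => (BM K).birthScale f = j).card : ℝ) ≤ 1 * (LW ^ 4) ^ (k - j) := by
  intro k b j _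
  have h1 : (((({b} : Finset (BM K).Birth)).filter fun f => (BM K).birthScale f = j).card : ℝ) ≤ 1 := by
    exact_mod_cast (Finset.card_filter_le _ _).trans (Finset.card_singleton b).le
  exact h1.trans (by simpa using one_le_pow₀ (M₀ := ℝ) (a := LW ^ 4) (n := k - j) (one_le_pow₀ one_le_LW))

/-- (w1)+(w5b) `hbirth` by `birthsFromOld_of_diag`: `C·gen b 0 = 2·a_K·(c_M + 3) = τ^K` EXACTLY. [folklore] -/
theorem hbirthM (K : ℕ) :
    (TM K).BirthsFromOld (4 * (1 / 2) / 1) (fun _ : ℕ => (LW ^ 2)⁻¹ * alphaCell (1 / 2))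
      (twoRate 1 (rhoOne (LW ^ 2)⁻¹ (4 * (1 / 2) / 1) 0 (1 / 2)) (LW⁻¹ ^ 3) (BM K).K)
      (budgetGate (TM K) (fun _ _ => 0) (1 / 4) (fun _ b => {b}) (4 * (1 / 2) / 1)
        (fun _ : ℕ => (LW ^ 2)⁻¹ * alphaCell (1 / 2))) :=
  Trajectory.birthsFromOld_of_diag fun b => by
    show 4 * (1 / 2) / 1 * (if (0 : ℕ) = 0 then aM K * (cM + 3) else 0) ≤
      twoRate 1 (rhoOne (LW ^ 2)⁻¹ (4 * (1 / 2) / 1) 0 (1 / 2)) (LW⁻¹ ^ 3) K 0 0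
    have hc : 0 < cM + 3 := by linarith [cM_pos]
    simp only [↓reduceIte, twoRate, Nat.sub_zero, pow_zero, mul_one, one_mul]
    unfold aM
    rw [show 4 * (1 / 2 : ℝ) / 1 * ((LW⁻¹ ^ 3) ^ K / (2 * (cM + 3)) * (cM + 3)) = (LW⁻¹ ^ 3) ^ K by field_simp; ring]

/-- (w5) `hreg`: no regeneration (later generations are `0`), for ANY gate. [folklore] -/
theorem hregM (K : ℕ) (Gate : ℕ → Prop) : (TM K).RegeneratesFromVar (fun _ : ℕ => (0 : ℝ)) Gate :=
  fun b k _ _ _ => by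
    show (if k + 1 = 0 then aM K * (cM + 3) else 0) ≤ 0 * ((BM K).size b k)
    simp

/-- The toy is non-degenerate: every booked size is positive at every cutoff and scale. [folklore] -/
theorem towerM_size_pos (K k : ℕ) (b : (BM K).Birth) : 0 < (BM K).size b k := mul_pos (aM_pos K) (defW_pos (k + 1))

/-- The dressing genuinely acts: `FnM K 0 1 ≠ FnM K 0 0` (`shift 1 = δf_0·e^{−x_0}∕(1+e^{−x_0}) > 0`). [folklore] -/
theorem FnM_one_ne_birth (K : ℕ) : FnM K 0 1 ≠ FnM K 0 0 := fun h => by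
  have h0 := congrFun h 0
  have ha : (aM K : ℂ) ≠ 0 := by exact_mod_cast (aM_pos K).ne'
  have hs : (0 : ℝ) < dfW 0 * (wtM K 0 / (1 + wtM K 0)) := by
    have := wtM_pos K 0; have := dfW_pos 0; positivity
  simp only [FnM, ↓reduceIte, ev₀₀_zero, zero_add, shiftM, Complex.ofReal_zero] at h0
  have h1 := mul_left_cancel₀ ha h0
  have h2 : dfW 0 * (wtM K 0 / (1 + wtM K 0)) = 0 := by exact_mod_cast h1
  linarith

end Summit.QuantumFields.BalabanUV.T4Continuum.NE1p.DressedTowerWitnessSlice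

end
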